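import Summits.Ventures.CertifiedManyBodySolver.Rows.DopedTLCorrBundleWN
import Literature.MathematicalPhysics.QuantumLattice.HubbardOneSpinDiagHopKinematicRow
import HarnessLib

/-!
# Bundle-WN rows WITH THE T′-BOX PER-LETTER PREMISE (K2 rung (1′), «T′-BOX» edition): the claim-node SHAPE of a pinned `t′`-pair
# read whose reader carried the two declared per-letter rows `--ext 25:-h:h --ext 116:-h:h` on the one-spin `D₄`-averaged
# diagonal-bond letters `v↑ = ⟨c†_{0↑} c_{x̂+ŷ,↑}⟩_G`, `v↓ = ⟨c†_{0↓} c_{x̂+ŷ,↓}⟩_G`, and its UNCONDITIONAL elimination into the plain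
# bundle-WN row — the premise is one-body kinematics true for EVERY torus limit of unit vectors
# (`InfVolFermionState.IsTorusLimitOf.abs_oneSpinDiagBondLetter_le`, hubbard-cov-la214-unc-3, Lieb–Loss bathtub: `|v_σ| ≤ 2/π² < 2027/10⁴`)
# (cell `pub/hubbard-obs`, D-0154 (1)(C) COVERAGE Hg-1201; captain hubbard-cov-hg1201-plan-1 g3 RULING 2026-08-28T12:53:16Z (E) «T′-BOX» and
# WORD 2026-08-28T13:38:50Z «type the T′-BOX extra-premise node shape now»; literal of record `h♯ = 2027/10000`, calibration twin `h = 79/250`)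

HONEST FRAMING: NOTHING IS ASSERTED HERE: two `def … : Prop`-valued shapes and solver-free edges; no `sorry`, no named fact, zero compute.
Companion of `Rows/DopedTLCorrBundleWN.lean` / `Rows/DopedTLCorrBundleWND.lean` (same seat, `hubbard-cov-hg1201-box-1`, `prover-hubbard-cov-hg1201-box-1-g0-0`).
THE DICTIONARY (node typist's business, stated once here): the premise is typed on unc-3's observable, `|Re ω(E′_σ)/4| ≤ h` with
`E′_σ = oneSpinDiagBondObs σ` on `thicken {0} 1`; by `re_expect_oneSpinDiagBondObs_eq_sum_twoPoint` (Hermiticity only) `Re ω(E′_σ) = Σ_{δ diagonal} Re ω(c†_{0σ} c_{δσ})`,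
so for the TRANSLATION-INVARIANT states the rows quantify over (torus limits of sector ground states) `Re ω(E′_σ)/4` is the mean over the four diagonal bonds
= the `D₄ ⋉ ℤ²`-average of `Re ⟨c†_{0σ} c_{x̂+ŷ,σ}⟩`, i.e. exactly the reader's letter `v25` (`σ = ↑`) / `v116` (`σ = ↓`) on the state's symmetrised moment vector.

* §A the per-letter box predicate `oneSpinDiagLetterBox h ω` and the SHAPE `SquareTTPrimeBundleOrbitLowerRowWNT U₁ U₂ s₁ s₂ flo cap h F sl₁ sl₂ n₀ S Λ X`
  (= `…WN` with the extra premise `oneSpinDiagLetterBox h ω`);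
* §B edges: WN ⇒ WNT (any `h`); monotonicity in `h` (a row declared with a BIGGER box serves every smaller one); the DISCHARGE
  `IsTorusLimitOf.oneSpinDiagLetterBox` for every `h ≥ 2027/10000`; hence **`…WNT.toWN` for every `h ≥ 2027/10000`** — every WN closer applies unchanged
  (`covHg1201M19b_PatchBottom_of_subBundleWN_asFired`, `covHg1201M19_PatchBottomM19_of_bundleWN_affineCap`, the @10 twins);
* §C the THICK box window row from a WNT row (`h ≥ 2027/10000`), same conclusion as `…WN.orbitLowerBoxRowW_thick[_rat]`.

References: S. Boyd, L. Vandenberghe, *Convex Optimization* (2004) §5.9 [BoydVandenberghe2004]; E. H. Lieb, M. Loss, Duke Math. J. 71 (1993) 337, §8 Thm 8.2 [LiebLoss1993];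
J. Wang et al., PRX 14 (2024) 031006, §III [WangEtAl2024].
-/

noncomputable section

namespace Summit.Ventures.CertifiedManyBodySolver

open Literature.MathematicalPhysics.QuantumLattice
open Matrix HubbardWave0 Literature.Probability.LatticeModels ThermodynamicLimit Filter Topology
open Summit.Ventures.CertifiedManyBodySolver.Downfold (wnBundleValue)
open scoped BigOperators ComplexOrder

/-! ## §A  The per-letter box predicate and the bundle-WN row shape with the T′-BOX premise -/

/-- §A **THE PER-LETTER T′-BOX** `oneSpinDiagLetterBox h ω`: for both spins `σ`, `|Re ω(E′_σ)/4| ≤ h` — the one-spin `D₄`-averaged diagonal-bond letter of a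
translation-invariant state lies in `[−h, h]` (reader rows `--ext 25:-h:h --ext 116:-h:h`). [cite: LiebLoss1993, §8, Theorem 8.2] -/
def oneSpinDiagLetterBox (h : ℚ) (ω : InfVolFermionState 2) : Prop :=
  ∀ σ : Fin 2, |(ω.expect (thicken ({0} : Finset (Site 2)) 1) (oneSpinDiagBondObs σ)).re / 4| ≤ ((h : ℚ) : ℝ)

/-- §A **BUNDLE-WN ROW SHAPE WITH THE T′-BOX PREMISE** `SquareTTPrimeBundleOrbitLowerRowWNT U₁ U₂ s₁ s₂ flo cap h F sl₁ sl₂ n₀ S Λ X`: as `SquareTTPrimeBundleOrbitLowerRowWN`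
(parameter rectangle, window functions `flo cap`, every density `x ∈ [0, 2)`, every torus limit of unit sector ground states at `(s, U, x)`), with ONE extra premise on the
state: `oneSpinDiagLetterBox h ω`; conclusion `wnBundleValue F sl₁ sl₂ n₀ x ≤ |S|⁻¹ Σ_{γ ∈ S} Re ω_{γΛ}(Γ(d4Emb γ 0) X)`. [cite: BoydVandenberghe2004, §5.9] -/
def SquareTTPrimeBundleOrbitLowerRowWNT (U₁ U₂ s₁ s₂ : ℝ) (flo cap : ℝ → ℝ → ℝ) (h : ℚ) (F sl₁ sl₂ n₀ : ℚ)
    (S : Finset (DihedralGroup 4)) (Λ : Finset (Site 2)) (X : FermionOp Λ) : Prop :=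
  ∀ U ∈ Set.Icc U₁ U₂, ∀ s ∈ Set.Icc s₁ s₂, ∀ x : ℝ, 0 ≤ x → x < 2 →
    ∀ (ω : InfVolFermionState 2) (Ls : ℕ → ℕ) (ψ : ∀ L, Fock (Orb (FermionTorus 2 L))),
      Tendsto Ls atTop atTop →
      (∀ j, IsGroundStateInSector (hubbardTorusTT' (Ls j) 1 s U) (rectN x (Ls j)) 0 (ψ (Ls j))) →
      (∀ j, star (ψ (Ls j)) ⬝ᵥ ψ (Ls j) = 1) → ω.IsTorusLimitOf ψ Ls →
      flo U s ≤ energyDensityTT' 1 s U x → energyDensityTT' 1 s U x ≤ cap U s → oneSpinDiagLetterBox h ω →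
      wnBundleValue F sl₁ sl₂ n₀ x ≤
        (S.card : ℝ)⁻¹ * ∑ g ∈ S, (ω.expect (d4ShiftSet g 0 Λ) (fermionEmbed (PolySite.d4Emb g 0 Λ) X)).re

/-! ## §B  Solver-free edges and the discharge -/

section Edges

variable {U₁ U₂ s₁ s₂ : ℝ} {flo cap : ℝ → ℝ → ℝ} {h h' F sl₁ sl₂ n₀ : ℚ} {S : Finset (DihedralGroup 4)}
  {Λ : Finset (Site 2)} {X : FermionOp Λ}

/-- `h`-monotonicity of the box: a SMALLER box is inside a bigger one. [folklore] -/
theorem oneSpinDiagLetterBox.mono {ω : InfVolFermionState 2} (hω : oneSpinDiagLetterBox h ω) (hh : h ≤ h') : oneSpinDiagLetterBox h' ω := by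
  intro σ
  have hh' : ((h : ℚ) : ℝ) ≤ ((h' : ℚ) : ℝ) := by exact_mod_cast hh
  exact (hω σ).trans hh'

/-- **THE DISCHARGE**: every torus limit of unit vectors lies in the per-letter box for EVERY `h ≥ 2027/10000` (unc-3's one-spin bathtub row `|Re ω(E′_σ)/4| ≤ 2/π² < 2027/10⁴`;
no ground-state, sector or symmetry hypothesis). [cite: LiebLoss1993, §8, Theorem 8.2] -/
theorem oneSpinDiagLetterBox_of_isTorusLimitOf {ω : InfVolFermionState 2} {ψ : ∀ L, Fock (Orb (FermionTorus 2 L))} {Ls : ℕ → ℕ}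
    (hω : ω.IsTorusLimitOf ψ Ls) (hLs : Tendsto Ls atTop atTop) (h1 : ∀ j, star (ψ (Ls j)) ⬝ᵥ ψ (Ls j) = 1) (hh : (2027 / 10000 : ℚ) ≤ h) :
    oneSpinDiagLetterBox h ω := by
  intro σ
  have hh' : ((2027 / 10000 : ℚ) : ℝ) ≤ ((h : ℚ) : ℝ) := by exact_mod_cast hh
  have hb := (hω.abs_oneSpinDiagBondLetter_le hLs h1 σ).2.2.1
  push_cast at hh'
  exact hb.trans hh'

/-- A plain bundle-WN row is a WNT row for EVERY box literal (the extra premise is simply not used). [folklore] -/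
theorem SquareTTPrimeBundleOrbitLowerRowWN.toWNT (hr : SquareTTPrimeBundleOrbitLowerRowWN U₁ U₂ s₁ s₂ flo cap F sl₁ sl₂ n₀ S Λ X) (h : ℚ) :
    SquareTTPrimeBundleOrbitLowerRowWNT U₁ U₂ s₁ s₂ flo cap h F sl₁ sl₂ n₀ S Λ X :=
  fun U hU s hs x hx0 hx2 ω Ls ψ hLs hψ hψ1 hω hl hu _ => hr U hU s hs x hx0 hx2 ω Ls ψ hLs hψ hψ1 hω hl hu

/-- `h`-monotonicity of the row: a WNT row declared with a box `h'` is one for every SMALLER box `h ≤ h'` (fewer states qualify); so a node read at `h = 79/250` also serves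
`h♯ = 2027/10000`. [folklore] -/
theorem SquareTTPrimeBundleOrbitLowerRowWNT.mono_h (hr : SquareTTPrimeBundleOrbitLowerRowWNT U₁ U₂ s₁ s₂ flo cap h' F sl₁ sl₂ n₀ S Λ X) (hh : h ≤ h') :
    SquareTTPrimeBundleOrbitLowerRowWNT U₁ U₂ s₁ s₂ flo cap h F sl₁ sl₂ n₀ S Λ X :=
  fun U hU s hs x hx0 hx2 ω Ls ψ hLs hψ hψ1 hω hl hu hb => hr U hU s hs x hx0 hx2 ω Ls ψ hLs hψ hψ1 hω hl hu (hb.mono hh)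

/-- **WNT ⇒ WN for every box `h ≥ 2027/10000`**: the T′-BOX premise is discharged on every state the row quantifies over, so EVERY bundle-WN closer consumes a T′-BOX node
unchanged. [cite: LiebLoss1993, §8, Theorem 8.2] [cite: BoydVandenberghe2004, §5.9] -/
theorem SquareTTPrimeBundleOrbitLowerRowWNT.toWN (hr : SquareTTPrimeBundleOrbitLowerRowWNT U₁ U₂ s₁ s₂ flo cap h F sl₁ sl₂ n₀ S Λ X) (hh : (2027 / 10000 : ℚ) ≤ h) :
    SquareTTPrimeBundleOrbitLowerRowWN U₁ U₂ s₁ s₂ flo cap F sl₁ sl₂ n₀ S Λ X :=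
  fun U hU s hs x hx0 hx2 ω Ls ψ hLs hψ hψ1 hω hl hu =>
    hr U hU s hs x hx0 hx2 ω Ls ψ hLs hψ hψ1 hω hl hu (oneSpinDiagLetterBox_of_isTorusLimitOf hω hLs hψ1 hh)

end Edges

/-! ## §C  WNT SHAPE (`h ≥ 2027/10000`) ⇒ the THICK box window row -/

section Thick

variable {U₁ U₂ s₁ s₂ : ℝ} {flo cap : ℝ → ℝ → ℝ} {h F sl₁ sl₂ n₀ : ℚ} {S : Finset (DihedralGroup 4)}
  {Λ : Finset (Site 2)} {X : FermionOp Λ}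

/-- **WNT SHAPE ⇒ THICK BOX WINDOW ROW** (`h ≥ 2027/10000`; `0 ≤ n₁`, `n₂ < 2`; a rational slot `r` below the four end values): the plain
`SquareTTPrimeCorrOrbitLowerBoxRowW ![U₁, s₁, n₁] ![U₂, s₂, n₂] …`. [cite: BoydVandenberghe2004, §5.9] [cite: WangEtAl2024, §III] -/
theorem SquareTTPrimeBundleOrbitLowerRowWNT.orbitLowerBoxRowW_thick
    (hr : SquareTTPrimeBundleOrbitLowerRowWNT U₁ U₂ s₁ s₂ flo cap h F sl₁ sl₂ n₀ S Λ X) (hh : (2027 / 10000 : ℚ) ≤ h) {n₁ n₂ : ℝ} (hn₁ : 0 ≤ n₁) (hn₂ : n₂ < 2)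
    {r : ℚ}
    (h₁₁ : ((r : ℚ) : ℝ) ≤ ((F : ℚ) : ℝ) + ((sl₁ : ℚ) : ℝ) * (n₁ - ((n₀ : ℚ) : ℝ)))
    (h₁₂ : ((r : ℚ) : ℝ) ≤ ((F : ℚ) : ℝ) + ((sl₁ : ℚ) : ℝ) * (n₂ - ((n₀ : ℚ) : ℝ)))
    (h₂₁ : ((r : ℚ) : ℝ) ≤ ((F : ℚ) : ℝ) + ((sl₂ : ℚ) : ℝ) * (n₁ - ((n₀ : ℚ) : ℝ)))
    (h₂₂ : ((r : ℚ) : ℝ) ≤ ((F : ℚ) : ℝ) + ((sl₂ : ℚ) : ℝ) * (n₂ - ((n₀ : ℚ) : ℝ))) :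
    SquareTTPrimeCorrOrbitLowerBoxRowW ![U₁, s₁, n₁] ![U₂, s₂, n₂] (fun θ => flo (θ 0) (θ 1)) (fun θ => cap (θ 0) (θ 1))
      r S Λ X :=
  (hr.toWN hh).orbitLowerBoxRowW_thick hn₁ hn₂ h₁₁ h₁₂ h₂₁ h₂₂

/-- **The same with RATIONAL density ends.** [cite: BoydVandenberghe2004, §5.9] -/
theorem SquareTTPrimeBundleOrbitLowerRowWNT.orbitLowerBoxRowW_thick_rat
    (hr : SquareTTPrimeBundleOrbitLowerRowWNT U₁ U₂ s₁ s₂ flo cap h F sl₁ sl₂ n₀ S Λ X) (hh : (2027 / 10000 : ℚ) ≤ h) {n₁ n₂ : ℚ} (hn₁ : 0 ≤ n₁) (hn₂ : n₂ < 2)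
    {r : ℚ} (h₁₁ : r ≤ F + sl₁ * (n₁ - n₀)) (h₁₂ : r ≤ F + sl₁ * (n₂ - n₀)) (h₂₁ : r ≤ F + sl₂ * (n₁ - n₀))
    (h₂₂ : r ≤ F + sl₂ * (n₂ - n₀)) :
    SquareTTPrimeCorrOrbitLowerBoxRowW ![U₁, s₁, ((n₁ : ℚ) : ℝ)] ![U₂, s₂, ((n₂ : ℚ) : ℝ)] (fun θ => flo (θ 0) (θ 1))
      (fun θ => cap (θ 0) (θ 1)) r S Λ X :=
  (hr.toWN hh).orbitLowerBoxRowW_thick_rat hn₁ hn₂ h₁₁ h₁₂ h₂₁ h₂₂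

end Thick

end Summit.Ventures.CertifiedManyBodySolver

end
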